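import Mathlib
import Literature.Analysis.FluidPDE.VectorCalculus

/-!
# Translation covariance of the crux's binders `u`, `W`, `T` and the EXACT value of the linearised normal-velocity map on constant
# fields (crux `Clause13RNearStraightL`, stmt-NavierStokesRegularity-23612; line `rate_bordered_split`, stubs `stub_rateRow13RFlat` /
# `stub_clamped13JBordered`; also the `SkeletonJ1R` family, stmt-23610)

Route `FilamentSkeletonRss`, Variant A1R.  In every statement of the `SkeletonJ1*` / `Clause13*` family the objects are let-bound by
`hu : u Z y = Σ_k (Γγ_k/4π) • ∫ ((‖y − Z k σ‖² + κ·Aa k σ)^{3/2})⁻¹ • (Z_k′σ × (y − Z k σ)) dσ` and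
`hT : T Z j τ = W − (⟪W, Z_j′τ⟫/‖Z_j′τ‖²)•Z_j′τ`, `W = u Z (Z j τ) + ½ Z j τ − α e₃ × Z j τ`, and both registered stubs of the line measure a
variation `Y` through `deriv (fun s => T (fun k σ => X k σ + s•Y k σ) j τ) 0`.

The landed `…Clause13RotationCovariance` (hand fsrs-3-g0) records the ONE exact continuous symmetry of these binders (rotations about `e₃`).
THIS FILE records the second natural one-parameter family — rigid TRANSLATIONS `Z ↦ Z + e` — which is an exact symmetry of the matched
Biot–Savart binder `u` but NOT of the similarity-frame velocity `W` (the strain `½y` and the rotation `−α e₃ × y` are affine, not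
translation invariant).  The failure is EXPLICIT and AFFINE, which gives, with NO analytic side condition (no integrability, no
differentiability of the Biot–Savart integral, no tangency, any cores `Aa`, any `Γ, γ, α`, every station `τ`, in or off the ball):

* `biotSavart_translation_invariant` — `u (Z + e) (y + e) = u Z y` (the integrand is literally unchanged: `deriv (Z_k + e) = deriv Z_k`
  unconditionally and `(y + e) − (Z_k σ + e) = y − Z_k σ`);
* `velocity_translation` — `W(Z + e, y + e) = W(Z, y) + d(e)`, `d(e) := ½e − α e₃ × e`;
* `tangencyDefect_translation` — **`T (Z + e) j τ = T Z j τ + P_τ d(e)`**, `P_τ w := w − (⟪w, Z_j′τ⟫/‖Z_j′τ‖²)•Z_j′τ` the binder's own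
  normal projector;
* `tangencyDefect_family_const` / `hasDerivAt_tangencyDefect_family_const` / `deriv_tangencyDefect_family_const` — the displaced family in a
  CONSTANT direction `Y_k σ := e` is AFFINE in `s`: `T (Z + s•e) j τ = T Z j τ + s • P_τ d(e)`, hence the crux's linearised map has the exact
  value **`DT·e = P_τ(½e − α e₃ × e)`** at every station (a genuine `HasDerivAt`, not a junk `deriv`);
* `deriv_tangencyDefect_family_vertical` — for the similarity axis `e = e₃`: **`DT·e₃ = ½ P_τ e₃`**; and `tangencyDefect_vertical_translate` —
  if the skeleton is tangent at a station (`T Z j τ = 0`, clause 8 on the ball) then its vertical translate has defect EXACTLY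
  `T (Z + h•e₃) j τ = (h/2) • P_τ e₃`, whose size at a unit-speed station is `(|h|/2)·√(1 − ⟪e₃, Z_j′τ⟫²)` (`norm_sub_inner_smul_sq`), hence
  `≥ (|h|/2)·√(θ₀(2−θ₀))` under the tilt clause 10 `|⟪Z_j′(c_j), e₃⟫| ≤ 1 − θ₀` (`vertical_translate_defect_lower_bound`): the similarity strain
  PINS THE VERTICAL POSITION of an in-ball-tangent skeleton — there is no vertical-translation degeneracy next to the rotation mode.

Uses for the open stubs (honest): (i) explicit, side-condition-free RANGE ELEMENTS of the linearised map (`P_τ(½e − α e₃×e)` for the three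
translations) against which any candidate exact annihilator / cokernel element of route (ii) of the 23612 repair census (hand fsrs-8-g0, evidence
#25–#28) can be tested after cut-off; (ii) for STUB J / 13-J: the cut-off vertical translation is an `O(1)`-forcing / `O(1)`-response pair
(tightness bookkeeping for the weighted exponent, consistent with `b ≥ 0`); (iii) for the ∃-side Newton step (K-B′ of stmt-23610): the
linearisation at a tangent skeleton is injective on vertical translations with the explicit constant `½√(θ₀(2−θ₀))`.

Hand `leafhand-ns-filamentskeletonrs-8-g1` (LAND-ONLY); `--supports stmt-NavierStokesRegularity-23612` helper.  HONEST FRAMING: symmetry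
bookkeeping for a HYPOTHETICAL filament skeleton on the NEGATIVE side of a MODEL blow-up route; neither stub nor the crux is proved here, and
nothing in this file bears on Navier–Stokes regularity or blow-up.
-/

noncomputable section

open scoped InnerProductSpace BigOperators
open MeasureTheory
open Literature.Analysis.FluidPDE

namespace Summit.NavierStokesRegularity.NavierStokesRegularity.Theorems.Clause13TranslationCovariance
set_option linter.dupNamespace false

/-! ## §1 Vector-algebra helpers -/

/-- Translating a parametrised curve by a constant vector does not change its derivative — unconditionally (both sides are junk `0`
together). [folklore] -/
theorem deriv_add_const_vec (Z : ℝ → EuclideanSpace ℝ (Fin 3)) (e : EuclideanSpace ℝ (Fin 3)) (σ : ℝ) :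
    deriv (fun s => Z s + e) σ = deriv Z σ :=
  deriv_add_const e

/-- The affine defect of a translation in the similarity frame, `d(e) = ½e − α e₃ × e`, is LINEAR in `e`. [folklore] -/
theorem translationDefect_smul (α s : ℝ) (e : EuclideanSpace ℝ (Fin 3)) :
    (1 / 2 : ℝ) • (s • e) - α • cross (EuclideanSpace.single 2 1) (s • e)
      = s • ((1 / 2 : ℝ) • e - α • cross (EuclideanSpace.single 2 1) e) := by
  have hc : cross (EuclideanSpace.single 2 1) (s • e) = s • cross (EuclideanSpace.single 2 1) e := by
    rw [← crossCLM_apply, map_smul, crossCLM_apply]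
  rw [hc, smul_sub, smul_comm s (1 / 2 : ℝ) e, smul_comm s α]

/-- The binder's normal projector `P_t w = w − (⟪w,t⟫/‖t‖²)•t` is linear: scalar multiples. [folklore] -/
theorem nproj_smul (s : ℝ) (w t : EuclideanSpace ℝ (Fin 3)) :
    s • w - (⟪s • w, t⟫_ℝ / ‖t‖ ^ 2) • t = s • (w - (⟪w, t⟫_ℝ / ‖t‖ ^ 2) • t) := by
  rw [real_inner_smul_left, smul_sub, smul_smul, mul_div_assoc]

/-! ## §2 Translation covariance of the binders -/

/-- **Translation invariance of the matched Biot–Savart binder**: `u (Z + e) (y + e) = u Z y`, for ANY cores `Aa`, with no integrability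
hypothesis (the two integrands coincide pointwise). [folklore] -/
theorem biotSavart_translation_invariant {N : ℕ} {Γ κ : ℝ} {γ : Fin N → ℝ} {Aa : Fin N → ℝ → ℝ}
    {u : (Fin N → ℝ → EuclideanSpace ℝ (Fin 3)) → EuclideanSpace ℝ (Fin 3) → EuclideanSpace ℝ (Fin 3)}
    (hu : ∀ Z y, u Z y = ∑ k, (Γ * γ k / (4 * Real.pi)) • ∫ σ : ℝ,
      ((‖y - Z k σ‖ ^ 2 + κ * Aa k σ) ^ (3 / 2 : ℝ))⁻¹ • cross (deriv (Z k) σ) (y - Z k σ))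
    (Z : Fin N → ℝ → EuclideanSpace ℝ (Fin 3)) (e y : EuclideanSpace ℝ (Fin 3)) :
    u (fun k σ => Z k σ + e) (y + e) = u Z y := by
  rw [hu, hu]
  refine Finset.sum_congr rfl fun k _ => ?_
  congr 1
  refine integral_congr_ae (Filter.Eventually.of_forall fun σ => ?_)
  simp only [deriv_add_const_vec, add_sub_add_right_eq_sub]

/-- **Translation covariance of the similarity-frame velocity** `W(Z, y) = u Z y + ½y − α e₃ × y`:
`W(Z + e, y + e) = W(Z, y) + (½e − α e₃ × e)`. [folklore] -/
theorem velocity_translation {N : ℕ} {Γ κ α : ℝ} {γ : Fin N → ℝ} {Aa : Fin N → ℝ → ℝ}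
    {u : (Fin N → ℝ → EuclideanSpace ℝ (Fin 3)) → EuclideanSpace ℝ (Fin 3) → EuclideanSpace ℝ (Fin 3)}
    (hu : ∀ Z y, u Z y = ∑ k, (Γ * γ k / (4 * Real.pi)) • ∫ σ : ℝ,
      ((‖y - Z k σ‖ ^ 2 + κ * Aa k σ) ^ (3 / 2 : ℝ))⁻¹ • cross (deriv (Z k) σ) (y - Z k σ))
    (Z : Fin N → ℝ → EuclideanSpace ℝ (Fin 3)) (e y : EuclideanSpace ℝ (Fin 3)) :
    u (fun k σ => Z k σ + e) (y + e) + (1 / 2 : ℝ) • (y + e) - α • cross (EuclideanSpace.single 2 1) (y + e)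
      = (u Z y + (1 / 2 : ℝ) • y - α • cross (EuclideanSpace.single 2 1) y)
        + ((1 / 2 : ℝ) • e - α • cross (EuclideanSpace.single 2 1) e) := by
  have hc : cross (EuclideanSpace.single 2 1) (y + e)
      = cross (EuclideanSpace.single 2 1) y + cross (EuclideanSpace.single 2 1) e := by
    rw [← crossCLM_apply, map_add, crossCLM_apply, crossCLM_apply]
  rw [biotSavart_translation_invariant hu Z e y, smul_add, hc, smul_add]
  abel

/-- **TRANSLATION COVARIANCE OF THE TANGENCY DEFECT**: `T (Z + e) j τ = T Z j τ + P_τ(½e − α e₃ × e)` with the binder's own normal projector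
`P_τ w = w − (⟪w, Z_j′τ⟫/‖Z_j′τ‖²)•Z_j′τ`; `T`, `u` given by the crux's binders, every station `τ`, no side condition. [folklore] -/
theorem tangencyDefect_translation {N : ℕ} {Γ κ α : ℝ} {γ : Fin N → ℝ} {Aa : Fin N → ℝ → ℝ}
    {u : (Fin N → ℝ → EuclideanSpace ℝ (Fin 3)) → EuclideanSpace ℝ (Fin 3) → EuclideanSpace ℝ (Fin 3)}
    {T : (Fin N → ℝ → EuclideanSpace ℝ (Fin 3)) → Fin N → ℝ → EuclideanSpace ℝ (Fin 3)}
    (hu : ∀ Z y, u Z y = ∑ k, (Γ * γ k / (4 * Real.pi)) • ∫ σ : ℝ,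
      ((‖y - Z k σ‖ ^ 2 + κ * Aa k σ) ^ (3 / 2 : ℝ))⁻¹ • cross (deriv (Z k) σ) (y - Z k σ))
    (hT : ∀ Z j τ, T Z j τ = (u Z (Z j τ) + (1 / 2 : ℝ) • Z j τ - α • cross (EuclideanSpace.single 2 1) (Z j τ))
      - (⟪u Z (Z j τ) + (1 / 2 : ℝ) • Z j τ - α • cross (EuclideanSpace.single 2 1) (Z j τ), deriv (Z j) τ⟫_ℝ
          / ‖deriv (Z j) τ‖ ^ 2) • deriv (Z j) τ)
    (Z : Fin N → ℝ → EuclideanSpace ℝ (Fin 3)) (j : Fin N) (τ : ℝ) (e : EuclideanSpace ℝ (Fin 3)) :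
    T (fun k σ => Z k σ + e) j τ = T Z j τ
      + (((1 / 2 : ℝ) • e - α • cross (EuclideanSpace.single 2 1) e)
        - (⟪(1 / 2 : ℝ) • e - α • cross (EuclideanSpace.single 2 1) e, deriv (Z j) τ⟫_ℝ / ‖deriv (Z j) τ‖ ^ 2)
          • deriv (Z j) τ) := by
  rw [hT, hT]
  beta_reduce
  rw [deriv_add_const_vec (Z j) e τ, velocity_translation hu Z e (Z j τ) (α := α)]
  set W := u Z (Z j τ) + (1 / 2 : ℝ) • Z j τ - α • cross (EuclideanSpace.single 2 1) (Z j τ)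
  set d := (1 / 2 : ℝ) • e - α • cross (EuclideanSpace.single 2 1) e
  set t := deriv (Z j) τ
  rw [inner_add_left, add_div, add_smul]
  abel

/-! ## §3 The displaced family in a constant direction is affine: the exact value of the linearised map on constants -/

/-- The displaced family of the crux in a CONSTANT direction `Y_k σ := e` is AFFINE in the displacement parameter:
`T (Z + s•e) j τ = T Z j τ + s • P_τ(½e − α e₃ × e)`. [folklore] -/
theorem tangencyDefect_family_const {N : ℕ} {Γ κ α : ℝ} {γ : Fin N → ℝ} {Aa : Fin N → ℝ → ℝ}
    {u : (Fin N → ℝ → EuclideanSpace ℝ (Fin 3)) → EuclideanSpace ℝ (Fin 3) → EuclideanSpace ℝ (Fin 3)}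
    {T : (Fin N → ℝ → EuclideanSpace ℝ (Fin 3)) → Fin N → ℝ → EuclideanSpace ℝ (Fin 3)}
    (hu : ∀ Z y, u Z y = ∑ k, (Γ * γ k / (4 * Real.pi)) • ∫ σ : ℝ,
      ((‖y - Z k σ‖ ^ 2 + κ * Aa k σ) ^ (3 / 2 : ℝ))⁻¹ • cross (deriv (Z k) σ) (y - Z k σ))
    (hT : ∀ Z j τ, T Z j τ = (u Z (Z j τ) + (1 / 2 : ℝ) • Z j τ - α • cross (EuclideanSpace.single 2 1) (Z j τ))
      - (⟪u Z (Z j τ) + (1 / 2 : ℝ) • Z j τ - α • cross (EuclideanSpace.single 2 1) (Z j τ), deriv (Z j) τ⟫_ℝ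
          / ‖deriv (Z j) τ‖ ^ 2) • deriv (Z j) τ)
    (Z : Fin N → ℝ → EuclideanSpace ℝ (Fin 3)) (j : Fin N) (τ : ℝ) (e : EuclideanSpace ℝ (Fin 3)) (s : ℝ) :
    T (fun k σ => Z k σ + s • e) j τ = T Z j τ
      + s • (((1 / 2 : ℝ) • e - α • cross (EuclideanSpace.single 2 1) e)
        - (⟪(1 / 2 : ℝ) • e - α • cross (EuclideanSpace.single 2 1) e, deriv (Z j) τ⟫_ℝ / ‖deriv (Z j) τ‖ ^ 2)
          • deriv (Z j) τ) := by
  rw [tangencyDefect_translation hu hT Z j τ (s • e), translationDefect_smul, nproj_smul]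

/-- **`DT·e = P_τ(½e − α e₃ × e)` as a genuine derivative**: the displaced family in a constant direction has derivative
`P_τ(½e − α e₃ × e)` at EVERY parameter `s₀` (it is affine), in particular at `s₀ = 0`. [folklore] -/
theorem hasDerivAt_tangencyDefect_family_const {N : ℕ} {Γ κ α : ℝ} {γ : Fin N → ℝ} {Aa : Fin N → ℝ → ℝ}
    {u : (Fin N → ℝ → EuclideanSpace ℝ (Fin 3)) → EuclideanSpace ℝ (Fin 3) → EuclideanSpace ℝ (Fin 3)}
    {T : (Fin N → ℝ → EuclideanSpace ℝ (Fin 3)) → Fin N → ℝ → EuclideanSpace ℝ (Fin 3)}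
    (hu : ∀ Z y, u Z y = ∑ k, (Γ * γ k / (4 * Real.pi)) • ∫ σ : ℝ,
      ((‖y - Z k σ‖ ^ 2 + κ * Aa k σ) ^ (3 / 2 : ℝ))⁻¹ • cross (deriv (Z k) σ) (y - Z k σ))
    (hT : ∀ Z j τ, T Z j τ = (u Z (Z j τ) + (1 / 2 : ℝ) • Z j τ - α • cross (EuclideanSpace.single 2 1) (Z j τ))
      - (⟪u Z (Z j τ) + (1 / 2 : ℝ) • Z j τ - α • cross (EuclideanSpace.single 2 1) (Z j τ), deriv (Z j) τ⟫_ℝ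
          / ‖deriv (Z j) τ‖ ^ 2) • deriv (Z j) τ)
    (Z : Fin N → ℝ → EuclideanSpace ℝ (Fin 3)) (j : Fin N) (τ : ℝ) (e : EuclideanSpace ℝ (Fin 3)) (s₀ : ℝ) :
    HasDerivAt (fun s : ℝ => T (fun k σ => Z k σ + s • e) j τ)
      (((1 / 2 : ℝ) • e - α • cross (EuclideanSpace.single 2 1) e)
        - (⟪(1 / 2 : ℝ) • e - α • cross (EuclideanSpace.single 2 1) e, deriv (Z j) τ⟫_ℝ / ‖deriv (Z j) τ‖ ^ 2)
          • deriv (Z j) τ) s₀ := by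
  set D := ((1 / 2 : ℝ) • e - α • cross (EuclideanSpace.single 2 1) e)
        - (⟪(1 / 2 : ℝ) • e - α • cross (EuclideanSpace.single 2 1) e, deriv (Z j) τ⟫_ℝ / ‖deriv (Z j) τ‖ ^ 2)
          • deriv (Z j) τ with hD
  have hf : (fun s : ℝ => T (fun k σ => Z k σ + s • e) j τ) = fun s : ℝ => T Z j τ + s • D := by
    funext s
    rw [hD]
    exact tangencyDefect_family_const hu hT Z j τ e s
  rw [hf]
  have h := ((hasDerivAt_id s₀).smul_const D).const_add (T Z j τ)
  simpa using h

/-- **The exact value of the crux's linearised map on a constant field**: `deriv (fun s => T (Z + s•e) j τ) 0 = P_τ(½e − α e₃ × e)`,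
at every station, for the binders of 13-R / 13-J verbatim (constant direction `Y_k σ = e`). [folklore] -/
theorem deriv_tangencyDefect_family_const {N : ℕ} {Γ κ α : ℝ} {γ : Fin N → ℝ} {Aa : Fin N → ℝ → ℝ}
    {u : (Fin N → ℝ → EuclideanSpace ℝ (Fin 3)) → EuclideanSpace ℝ (Fin 3) → EuclideanSpace ℝ (Fin 3)}
    {T : (Fin N → ℝ → EuclideanSpace ℝ (Fin 3)) → Fin N → ℝ → EuclideanSpace ℝ (Fin 3)}
    (hu : ∀ Z y, u Z y = ∑ k, (Γ * γ k / (4 * Real.pi)) • ∫ σ : ℝ,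
      ((‖y - Z k σ‖ ^ 2 + κ * Aa k σ) ^ (3 / 2 : ℝ))⁻¹ • cross (deriv (Z k) σ) (y - Z k σ))
    (hT : ∀ Z j τ, T Z j τ = (u Z (Z j τ) + (1 / 2 : ℝ) • Z j τ - α • cross (EuclideanSpace.single 2 1) (Z j τ))
      - (⟪u Z (Z j τ) + (1 / 2 : ℝ) • Z j τ - α • cross (EuclideanSpace.single 2 1) (Z j τ), deriv (Z j) τ⟫_ℝ
          / ‖deriv (Z j) τ‖ ^ 2) • deriv (Z j) τ)
    (Z : Fin N → ℝ → EuclideanSpace ℝ (Fin 3)) (j : Fin N) (τ : ℝ) (e : EuclideanSpace ℝ (Fin 3)) :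
    deriv (fun s : ℝ => T (fun k σ => Z k σ + s • e) j τ) 0
      = ((1 / 2 : ℝ) • e - α • cross (EuclideanSpace.single 2 1) e)
        - (⟪(1 / 2 : ℝ) • e - α • cross (EuclideanSpace.single 2 1) e, deriv (Z j) τ⟫_ℝ / ‖deriv (Z j) τ‖ ^ 2)
          • deriv (Z j) τ :=
  (hasDerivAt_tangencyDefect_family_const hu hT Z j τ e 0).deriv

/-! ## §4 The similarity axis: vertical translations -/

/-- For the similarity axis `e₃` the rotation part drops (`e₃ × e₃ = 0`): `½e₃ − α e₃ × e₃ = ½ e₃`. [folklore] -/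
theorem translationDefect_vertical (α : ℝ) :
    (1 / 2 : ℝ) • (EuclideanSpace.single 2 1 : EuclideanSpace ℝ (Fin 3))
        - α • cross (EuclideanSpace.single 2 1) (EuclideanSpace.single 2 1)
      = (1 / 2 : ℝ) • EuclideanSpace.single 2 1 := by
  have hc : cross (EuclideanSpace.single 2 1 : EuclideanSpace ℝ (Fin 3)) (EuclideanSpace.single 2 1) = 0 := by
    simp only [cross, cross_self, WithLp.toLp_zero]
  rw [hc, smul_zero, sub_zero]

/-- **`DT·e₃ = ½ P_τ e₃`**: the crux's linearised map on the constant vertical field, exactly, at every station. [folklore] -/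
theorem deriv_tangencyDefect_family_vertical {N : ℕ} {Γ κ α : ℝ} {γ : Fin N → ℝ} {Aa : Fin N → ℝ → ℝ}
    {u : (Fin N → ℝ → EuclideanSpace ℝ (Fin 3)) → EuclideanSpace ℝ (Fin 3) → EuclideanSpace ℝ (Fin 3)}
    {T : (Fin N → ℝ → EuclideanSpace ℝ (Fin 3)) → Fin N → ℝ → EuclideanSpace ℝ (Fin 3)}
    (hu : ∀ Z y, u Z y = ∑ k, (Γ * γ k / (4 * Real.pi)) • ∫ σ : ℝ,
      ((‖y - Z k σ‖ ^ 2 + κ * Aa k σ) ^ (3 / 2 : ℝ))⁻¹ • cross (deriv (Z k) σ) (y - Z k σ))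
    (hT : ∀ Z j τ, T Z j τ = (u Z (Z j τ) + (1 / 2 : ℝ) • Z j τ - α • cross (EuclideanSpace.single 2 1) (Z j τ))
      - (⟪u Z (Z j τ) + (1 / 2 : ℝ) • Z j τ - α • cross (EuclideanSpace.single 2 1) (Z j τ), deriv (Z j) τ⟫_ℝ
          / ‖deriv (Z j) τ‖ ^ 2) • deriv (Z j) τ)
    (Z : Fin N → ℝ → EuclideanSpace ℝ (Fin 3)) (j : Fin N) (τ : ℝ) :
    deriv (fun s : ℝ => T (fun k σ => Z k σ + s • (EuclideanSpace.single 2 1 : EuclideanSpace ℝ (Fin 3))) j τ) 0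
      = (1 / 2 : ℝ) • ((EuclideanSpace.single 2 1 : EuclideanSpace ℝ (Fin 3))
          - (⟪(EuclideanSpace.single 2 1 : EuclideanSpace ℝ (Fin 3)), deriv (Z j) τ⟫_ℝ / ‖deriv (Z j) τ‖ ^ 2)
            • deriv (Z j) τ) := by
  rw [deriv_tangencyDefect_family_const hu hT Z j τ, translationDefect_vertical, nproj_smul]

/-- **Vertical translates of a tangent station have an explicit, `Γ`-independent defect**: if `T Z j τ = 0` (clause 8 at an in-ball station) then
`T (Z + h•e₃) j τ = (h/2) • P_τ e₃`. [folklore] -/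
theorem tangencyDefect_vertical_translate {N : ℕ} {Γ κ α : ℝ} {γ : Fin N → ℝ} {Aa : Fin N → ℝ → ℝ}
    {u : (Fin N → ℝ → EuclideanSpace ℝ (Fin 3)) → EuclideanSpace ℝ (Fin 3) → EuclideanSpace ℝ (Fin 3)}
    {T : (Fin N → ℝ → EuclideanSpace ℝ (Fin 3)) → Fin N → ℝ → EuclideanSpace ℝ (Fin 3)}
    (hu : ∀ Z y, u Z y = ∑ k, (Γ * γ k / (4 * Real.pi)) • ∫ σ : ℝ,
      ((‖y - Z k σ‖ ^ 2 + κ * Aa k σ) ^ (3 / 2 : ℝ))⁻¹ • cross (deriv (Z k) σ) (y - Z k σ))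
    (hT : ∀ Z j τ, T Z j τ = (u Z (Z j τ) + (1 / 2 : ℝ) • Z j τ - α • cross (EuclideanSpace.single 2 1) (Z j τ))
      - (⟪u Z (Z j τ) + (1 / 2 : ℝ) • Z j τ - α • cross (EuclideanSpace.single 2 1) (Z j τ), deriv (Z j) τ⟫_ℝ
          / ‖deriv (Z j) τ‖ ^ 2) • deriv (Z j) τ)
    {Z : Fin N → ℝ → EuclideanSpace ℝ (Fin 3)} {j : Fin N} {τ : ℝ} (h0 : T Z j τ = 0) (h : ℝ) :
    T (fun k σ => Z k σ + h • (EuclideanSpace.single 2 1 : EuclideanSpace ℝ (Fin 3))) j τ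
      = (h / 2) • ((EuclideanSpace.single 2 1 : EuclideanSpace ℝ (Fin 3))
          - (⟪(EuclideanSpace.single 2 1 : EuclideanSpace ℝ (Fin 3)), deriv (Z j) τ⟫_ℝ / ‖deriv (Z j) τ‖ ^ 2)
            • deriv (Z j) τ) := by
  rw [tangencyDefect_family_const hu hT Z j τ _ h, h0, zero_add, translationDefect_vertical, nproj_smul, smul_smul,
    mul_one_div]

/-! ## §5 Size of the vertical-translation defect at a unit-speed station -/

/-- Pythagoras for the normal part of a unit vector against a unit tangent: `‖e − ⟪e,t⟫t‖² = 1 − ⟪e,t⟫²` (`‖e‖ = ‖t‖ = 1`). [folklore] -/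
theorem norm_sub_inner_smul_sq (e t : EuclideanSpace ℝ (Fin 3)) (he : ‖e‖ = 1) (ht : ‖t‖ = 1) :
    ‖e - ⟪e, t⟫_ℝ • t‖ ^ 2 = 1 - ⟪e, t⟫_ℝ ^ 2 := by
  rw [@norm_sub_sq_real, he, norm_smul, ht, mul_one, Real.norm_eq_abs, sq_abs, real_inner_smul_right]
  ring

/-- At a UNIT-SPEED station the vertical-translation defect has size exactly `(|h|/2)·√(1 − ⟪e₃, Z_j′τ⟫²)`. [folklore] -/
theorem norm_vertical_translate_defect (t : EuclideanSpace ℝ (Fin 3)) (ht : ‖t‖ = 1) (h : ℝ) :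
    ‖(h / 2) • ((EuclideanSpace.single 2 1 : EuclideanSpace ℝ (Fin 3))
        - (⟪(EuclideanSpace.single 2 1 : EuclideanSpace ℝ (Fin 3)), t⟫_ℝ / ‖t‖ ^ 2) • t)‖
      = |h| / 2 * Real.sqrt (1 - ⟪(EuclideanSpace.single 2 1 : EuclideanSpace ℝ (Fin 3)), t⟫_ℝ ^ 2) := by
  have he : ‖(EuclideanSpace.single 2 1 : EuclideanSpace ℝ (Fin 3))‖ = 1 := by
    rw [PiLp.norm_single, norm_one]
  rw [ht, one_pow, div_one, norm_smul, Real.norm_eq_abs, abs_div, abs_two]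
  congr 1
  rw [← Real.sqrt_sq (norm_nonneg _), norm_sub_inner_smul_sq _ _ he ht]

/-- **The similarity strain pins the vertical position (tilt clause 10)**: at a unit-speed station with `|⟪Z_j′τ, e₃⟫| ≤ 1 − θ₀`,
the vertical translate by `h` of a tangent skeleton has defect of size at least `(|h|/2)·√(θ₀(2 − θ₀))`. [folklore] -/
theorem vertical_translate_defect_lower_bound (t : EuclideanSpace ℝ (Fin 3)) (ht : ‖t‖ = 1) {θ₀ : ℝ}
    (htilt : |⟪t, (EuclideanSpace.single 2 1 : EuclideanSpace ℝ (Fin 3))⟫_ℝ| ≤ 1 - θ₀) (h : ℝ) :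
    |h| / 2 * Real.sqrt (θ₀ * (2 - θ₀)) ≤
      ‖(h / 2) • ((EuclideanSpace.single 2 1 : EuclideanSpace ℝ (Fin 3))
        - (⟪(EuclideanSpace.single 2 1 : EuclideanSpace ℝ (Fin 3)), t⟫_ℝ / ‖t‖ ^ 2) • t)‖ := by
  rw [norm_vertical_translate_defect t ht h]
  refine mul_le_mul_of_nonneg_left (Real.sqrt_le_sqrt ?_) (by positivity)
  rw [real_inner_comm] at htilt
  have hsq : ⟪(EuclideanSpace.single 2 1 : EuclideanSpace ℝ (Fin 3)), t⟫_ℝ ^ 2 ≤ (1 - θ₀) ^ 2 := by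
    rw [← sq_abs]
    exact pow_le_pow_left₀ (abs_nonneg _) htilt 2
  nlinarith [hsq]

end Summit.NavierStokesRegularity.NavierStokesRegularity.Theorems.Clause13TranslationCovariance

end
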